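import Summits.BirchSwinnertonDyer.BirchSwinnertonDyer.Theses.MockTateDerivative
import Literature.NumberTheory.EllipticCurves.IwasawaLeadingTermProofs

/-!
# Strategy census r1 — Lean companion (redirect strategist `cstrat-stmt-BirchSwinnertonDyer-0132-r1`)

Crux `stmt-BirchSwinnertonDyer-0132` = `SelmerRankShaPFinite` (∀ E/ℚ ∀ p, `Ш(E/ℚ)[p^∞]` finite), as
consumed by the newest route `route-BirchSwinnertonDyer-MockTateDerivative` (born 2026-08-17).
Kernel-checked facts backing `STRATEGY-CENSUS-r1.md`:

* `crux_iff_selmerCorank_eq_rank` — the crux is *exactly* "points realise the whole `p^∞`-Selmer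
  corank, for every curve and every prime" (re-derived here; first proved in `IdeateR2K4.lean`).
* **Hidden summit on the sector (Decomposition §, route-relative).** `ShaPFiniteOnTateSector` is the
  precise instance of the crux that `MockTateDerivative.closes` consumes; `closes_of_shaOnTateSector`
  CERTIFIES that it can replace the crux in the deciding theorem (same other six binders, same
  conclusion), `shaOnTateSector_iff_pointsLB` shows it is *equivalent* to the rank lower bound
  `2 ≤ rank E(ℚ)` on the sector (the hard half of BSD-rank there), and `shaOnTateSector_of_bsd`
  that BSD-rank gives it back: the consumed slot is sandwiched between the summit-on-the-sector and
  itself.  `consumedSlot_iff_summit_of_rest` records the resulting equivalence modulo the route's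
  other items.
* **Points-form re-target (Strengthen § S2′ / census §0).** `MockPlecticPoints` — the route's own
  `VerticalKolyvagin` binders (sector, admissible `K`, finite-level mock-plectic certificate) with
  `r_an(E) = 2`, `r_an(E^{d_K}) = 0`, concluding `2 ≤ rank E(ℚ)`: the Fornea–Gehrmann algebraicity
  direction (arXiv:2311.03100 Conj. 2.15 / rank form of Conj. 2.13) typed at finite level.
  `closes_of_mockPointsW` is the certified MASTER glue (weakest consumed form), with corollaries
  `closes_of_shaOnTateSector`, `closes_of_mockPoints`; `mockPoints_of_shaOnTateSector` shows the
  points-form bets nothing beyond the Ш-form given the route's Selmer items.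
* **Typed splits (Decomposition §).** Σ3 `crux_of_paritySplit` (p-parity ∧ MW-parity ∧ corank Ш ≤ 1
  ⇒ crux) with converses `mwParity_of_crux`, `shaCorankLeOne_of_crux`; Σ5 `crux_of_onePrimeSplit`
  (finite at ONE prime ∧ `p`-independence of `corank Ш[p^∞]` ⇒ crux) with the known mod-2 rung
  `shaCorank_mod_two_indep_of_pParity`.  Why none is filed: census §Decomposition.

No `sorry`; imports = the route file + `IwasawaLeadingTermProofs` (for
`finite_primaryComponent_sha_iff_shaCorank_eq_zero`).
-/

namespace Summit.BirchSwinnertonDyer.BirchSwinnertonDyer.Cruxes.SelmerRankShaPFinite.CensusR1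

open scoped BigOperators Topology Manifold Classical MeasureTheory ProbabilityTheory Matrix InnerProductSpace ComplexConjugate ContinuousMap
open Filter Set Function TopologicalSpace MeasureTheory
open Summit.BirchSwinnertonDyer.BirchSwinnertonDyer.Theses.MockTateDerivative
open Literature

/-! ## 0. Bookkeeping lemmas -/

theorem selmer_eq_rank_add (W : WeierstrassCurve ℚ) [W.IsElliptic] (p : ℕ) [Fact p.Prime] :
    W.selmerCorank p = W.mordellWeilRank + W.shaCorank p :=
  W.selmerCorank_eq_mordellWeilRank_add_holds p

theorem finite_iff_shaCorank_zero (W : WeierstrassCurve ℚ) [W.IsElliptic] (p : ℕ) [Fact p.Prime] :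
    Finite ↥(AddCommGroup.primaryComponent W.sha p) ↔ W.shaCorank p = 0 :=
  Literature.NumberTheory.EllipticCurves.finite_primaryComponent_sha_iff_shaCorank_eq_zero W p

/-- The crux is exactly `∀ E ∀ p, corank Sel_{p^∞}(E/ℚ) = rank E(ℚ)`. -/
theorem crux_iff_selmerCorank_eq_rank :
    SelmerRankShaPFinite ↔
      ∀ (W : WeierstrassCurve ℚ) [W.IsElliptic] (p : ℕ) [Fact p.Prime],
        W.selmerCorank p = W.mordellWeilRank := by
  constructor
  · intro h W _ p _
    have h1 := selmer_eq_rank_add W p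
    have h2 := (finite_iff_shaCorank_zero W p).mp (h W p)
    omega
  · intro h W _ p _
    have h1 := selmer_eq_rank_add W p
    have h2 := h W p
    exact (finite_iff_shaCorank_zero W p).mpr (by omega)

/-! ## 1. The consumed slot of `MockTateDerivative.closes` and the hidden summit on the sector -/

/-- The instance of the crux consumed by `MockTateDerivative.closes`: on the non-split Tate sector
(globally minimal `V`, `p ≥ 5`, `N = pM`, `p ∤ M`, multiplicative and NOT split at `p`, `ρ̄_{E,p}`
surjective, `r_an = 2`) and GIVEN `corank Sel_{p^∞}(E/ℚ) = 2` (which the route derives from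
MockNonVanishing + VerticalKolyvagin + QuadraticSelmerCorank + RankLeOne), `Ш(E/ℚ)[p^∞]` is finite. -/
def ShaPFiniteOnTateSector : Prop :=
  ∀ (V : WeierstrassCurve ℚ) [V.IsElliptic] [V.IsGloballyMinimal] (p M : ℕ) [Fact p.Prime],
    5 ≤ p → V.conductorNorm ℤ = p * M → ¬ p ∣ M → V.HasMultiplicativeReductionAtPrime p →
    ¬ ((V.baseChange ℚ_[p]).minimal ℤ_[p]).HasSplitMultiplicativeReduction ℤ_[p] →
    V.HasSurjectiveModNGaloisRep p → V.analyticRank = 2 → V.selmerCorank p = 2 →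
    Finite ↥(AddCommGroup.primaryComponent V.sha p)

/-- The rank lower bound on the same sector: two independent rational points. -/
def PointsLBOnTateSector : Prop :=
  ∀ (V : WeierstrassCurve ℚ) [V.IsElliptic] [V.IsGloballyMinimal] (p M : ℕ) [Fact p.Prime],
    5 ≤ p → V.conductorNorm ℤ = p * M → ¬ p ∣ M → V.HasMultiplicativeReductionAtPrime p →
    ¬ ((V.baseChange ℚ_[p]).minimal ℤ_[p]).HasSplitMultiplicativeReduction ℤ_[p] →
    V.HasSurjectiveModNGaloisRep p → V.analyticRank = 2 → V.selmerCorank p = 2 →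
    2 ≤ V.mordellWeilRank

theorem shaOnTateSector_of_crux (h : SelmerRankShaPFinite) : ShaPFiniteOnTateSector :=
  fun V _ _ p _ _ _ _ _ _ _ _ _ _ => h V p

/-- **Hidden summit, part 1.** On the sector the consumed Ш-slot IS the rank lower bound. -/
theorem shaOnTateSector_iff_pointsLB : ShaPFiniteOnTateSector ↔ PointsLBOnTateSector := by
  constructor
  · intro h V _ _ p M _ h5 hN hpM hm hns hsurj hr2 hs
    have h1 := selmer_eq_rank_add V p
    have h2 := (finite_iff_shaCorank_zero V p).mp (h V p M h5 hN hpM hm hns hsurj hr2 hs)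
    omega
  · intro h V _ _ p M _ h5 hN hpM hm hns hsurj hr2 hs
    have h1 := selmer_eq_rank_add V p
    have h2 := h V p M h5 hN hpM hm hns hsurj hr2 hs
    exact (finite_iff_shaCorank_zero V p).mpr (by omega)

/-- **Hidden summit, part 2.** BSD-rank gives the consumed slot back. -/
theorem pointsLB_of_bsd (hB : _root_.BirchSwinnertonDyer) : PointsLBOnTateSector := by
  intro V hE _ p M _ h5 hN hpM hm hns hsurj hr2 hs
  have h := hB V hE
  omega

theorem shaOnTateSector_of_bsd (hB : _root_.BirchSwinnertonDyer) : ShaPFiniteOnTateSector :=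
  shaOnTateSector_iff_pointsLB.mpr (pointsLB_of_bsd hB)

/-- **Points form of the consumed slot (FG Conj. 2.15-flavoured re-target).** Same binders as the
route's `VerticalKolyvagin` (sector, admissible `K`, parametrisation datum, level `p^n`, CM points,
fields `K[p^n] ⊃ K[1]`, the point `y`, `σ`, transversal `S`, the finite-level certificate
"`Σ_s s(D_σ y) ∉ p^{n-1} E(L)`"), with `r_an(E) = 2` and `r_an(E^{d_K}) = 0` added, and conclusion: TWO
independent rational points.  This is the direction "mock plectic invariant ≠ 0 ⟹ global points"
(Fornea–Gehrmann, arXiv:2311.03100, Conj. 2.15 with Rem. 2.14 and Rem. 1.2), typed at finite level. -/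
def MockPlecticPoints : Prop :=
  ∀ (W : WeierstrassCurve ℚ) [W.IsElliptic] [W.IsGloballyMinimal] (p M : ℕ) [Fact p.Prime] [NeZero (W.conductorNorm ℤ)], 5 ≤ p → W.conductorNorm ℤ = p * M → ¬ p ∣ M → W.HasMultiplicativeReductionAtPrime p → ¬ ((W.baseChange ℚ_[p]).minimal ℤ_[p]).HasSplitMultiplicativeReduction ℤ_[p] → W.HasSurjectiveModNGaloisRep p → W.analyticRank = 2 → ∀ (K : Type) [Field K] [NumberField K] (ι : K →+* ℂ) (β c : ℤ), Module.finrank ℚ K = 2 → NumberField.IsTotallyComplex K → NumberField.discr K < -4 → Int.gcd (NumberField.discr K) (p * M) = 1 → ((Ideal.span {(p : ℤ)}).primesOver (NumberField.RingOfIntegers K)).ncard = 1 → β ^ 2 - NumberField.discr K = 4 * c → (M : ℤ) ∣ c → (W.quadraticTwist (NumberField.discr K : ℚ)).analyticRank = 0 → ∀ (Dt : Literature.NumberTheory.EllipticCurves.ModularForms.ModularParametrizationData W (W.conductorNorm ℤ)) (n : ℕ) (τ τ₁ : UpperHalfPlane) (L L₁ : Subfield ℂ) (y : (W.baseChange L).toAffine.Point)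 (σ : (L ≃ₐ[ℚ] L)) (S : Finset (L ≃ₐ[ℚ] L)), 2 ≤ n → (τ : ℂ) = ⟨-(β : ℝ) / (2 * (p ^ n : ℕ) * c), Real.sqrt (-(NumberField.discr K : ℝ)) / (2 * (p ^ n : ℕ) * c)⟩ → (τ₁ : ℂ) = ⟨-(β : ℝ) / (2 * c), Real.sqrt (-(NumberField.discr K : ℝ)) / (2 * c)⟩ → L = Subfield.closure (Set.range ι ∪ {Literature.NumberTheory.EllipticCurves.ModularForms.kleinJ τ}) → L₁ = Subfield.closure (Set.range ι ∪ {Literature.NumberTheory.EllipticCurves.ModularForms.kleinJ τ₁}) → WeierstrassCurve.Affine.Point.map L.subtype.toRatAlgHom y = Dt.φ τ → Subgroup.zpowers σ = fixingSubgroup (L ≃ₐ[ℚ] L) {x : L | (x : ℂ) ∈ L₁} → (∀ s ∈ S, s ∈ fixingSubgroup (L ≃ₐ[ℚ] L) {x : L | (x : ℂ) ∈ Set.range ι}) → (∀ g ∈ fixingSubgroup (L ≃ₐ[ℚ] L) {x : L | (x : ℂ) ∈ Set.range ι}, ∃! s, s ∈ S ∧ g⁻¹ * s ∈ fixingSubgroup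 (L ≃ₐ[ℚ] L) {x : L | (x : ℂ) ∈ L₁}) → (¬ ∃ z : (W.baseChange L).toAffine.Point, (p ^ (n - 1)) • z = ∑ s ∈ S, WeierstrassCurve.Affine.Point.map (W' := W) (s : L →ₐ[ℚ] L) (∑ i ∈ Finset.range ((p + 1) * p ^ (n - 1)), i • WeierstrassCurve.Affine.Point.map (W' := W) ((σ ^ i : L ≃ₐ[ℚ] L) : L →ₐ[ℚ] L) y)) → 2 ≤ W.mordellWeilRank

/-- The WEAKEST consumed form: `MockPlecticPoints` with `corank Sel_{p^∞}(E/ℚ) = 2` also given. -/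
def MockPlecticPointsW : Prop :=
  ∀ (W : WeierstrassCurve ℚ) [W.IsElliptic] [W.IsGloballyMinimal] (p M : ℕ) [Fact p.Prime] [NeZero (W.conductorNorm ℤ)], 5 ≤ p → W.conductorNorm ℤ = p * M → ¬ p ∣ M → W.HasMultiplicativeReductionAtPrime p → ¬ ((W.baseChange ℚ_[p]).minimal ℤ_[p]).HasSplitMultiplicativeReduction ℤ_[p] → W.HasSurjectiveModNGaloisRep p → W.analyticRank = 2 → ∀ (K : Type) [Field K] [NumberField K] (ι : K →+* ℂ) (β c : ℤ), Module.finrank ℚ K = 2 → NumberField.IsTotallyComplex K → NumberField.discr K < -4 → Int.gcd (NumberField.discr K) (p * M) = 1 → ((Ideal.span {(p : ℤ)}).primesOver (NumberField.RingOfIntegers K)).ncard = 1 → β ^ 2 - NumberField.discr K = 4 * c → (M : ℤ) ∣ c → (W.quadraticTwist (NumberField.discr K : ℚ)).analyticRank = 0 → ∀ (Dt : Literature.NumberTheory.EllipticCurves.ModularForms.ModularParametrizationData W (W.conductorNorm ℤ)) (n : ℕ) (τ τ₁ : UpperHalfPlane) (L L₁ : Subfield ℂ) (y : (W.baseChange L).toAffine.Point)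 (σ : (L ≃ₐ[ℚ] L)) (S : Finset (L ≃ₐ[ℚ] L)), 2 ≤ n → (τ : ℂ) = ⟨-(β : ℝ) / (2 * (p ^ n : ℕ) * c), Real.sqrt (-(NumberField.discr K : ℝ)) / (2 * (p ^ n : ℕ) * c)⟩ → (τ₁ : ℂ) = ⟨-(β : ℝ) / (2 * c), Real.sqrt (-(NumberField.discr K : ℝ)) / (2 * c)⟩ → L = Subfield.closure (Set.range ι ∪ {Literature.NumberTheory.EllipticCurves.ModularForms.kleinJ τ}) → L₁ = Subfield.closure (Set.range ι ∪ {Literature.NumberTheory.EllipticCurves.ModularForms.kleinJ τ₁}) → WeierstrassCurve.Affine.Point.map L.subtype.toRatAlgHom y = Dt.φ τ → Subgroup.zpowers σ = fixingSubgroup (L ≃ₐ[ℚ] L) {x : L | (x : ℂ) ∈ L₁} → (∀ s ∈ S, s ∈ fixingSubgroup (L ≃ₐ[ℚ] L) {x : L | (x : ℂ) ∈ Set.range ι}) → (∀ g ∈ fixingSubgroup (L ≃ₐ[ℚ] L) {x : L | (x : ℂ) ∈ Set.range ι}, ∃! s, s ∈ S ∧ g⁻¹ * s ∈ fixingSubgroup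 (L ≃ₐ[ℚ] L) {x : L | (x : ℂ) ∈ L₁}) → (¬ ∃ z : (W.baseChange L).toAffine.Point, (p ^ (n - 1)) • z = ∑ s ∈ S, WeierstrassCurve.Affine.Point.map (W' := W) (s : L →ₐ[ℚ] L) (∑ i ∈ Finset.range ((p + 1) * p ^ (n - 1)), i • WeierstrassCurve.Affine.Point.map (W' := W) ((σ ^ i : L ≃ₐ[ℚ] L) : L →ₐ[ℚ] L) y)) → W.selmerCorank p = 2 → 2 ≤ W.mordellWeilRank

theorem mockPointsW_of_mockPoints (h : MockPlecticPoints) : MockPlecticPointsW :=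
  fun W _ _ p M _ _ h5 hN hpM hm hns hsurj hr2 K _ _ ι β c hK2 hKc hd4 hgcd hinert hβ hMc htw Dt n τ τ₁ L L₁
      y σ S hn hτ hτ₁ hL hL₁ hy hσ hS1 hS2 hcert _ =>
    h W p M h5 hN hpM hm hns hsurj hr2 K ι β c hK2 hKc hd4 hgcd hinert hβ hMc htw Dt n τ τ₁ L L₁ y σ S hn hτ
      hτ₁ hL hL₁ hy hσ hS1 hS2 hcert

theorem mockPointsW_of_pointsLB (h : PointsLBOnTateSector) : MockPlecticPointsW :=
  fun W _ _ p M _ _ h5 hN hpM hm hns hsurj hr2 _K _ _ _ι _β _c _ _ _ _ _ _ _ _ _Dt _n _τ _τ₁ _L _L₁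
      _y _σ _S _ _ _ _ _ _ _ _ _ _ hs =>
    h W p M h5 hN hpM hm hns hsurj hr2 hs

theorem mockPointsW_of_shaOnTateSector (h : ShaPFiniteOnTateSector) : MockPlecticPointsW :=
  mockPointsW_of_pointsLB (shaOnTateSector_iff_pointsLB.mp h)

/-- **MASTER GLUE (certified).** `MockTateDerivative.closes` with the Ш-binder replaced by the WEAKEST
statement the proof actually needs at that point: `MockPlecticPointsW` — on the sector, for admissible
`K` and a finite-level mock-plectic certificate (the data of `MockNonVanishing`/`VerticalKolyvagin`), and
given `corank Sel_{p^∞}(E/ℚ) = 2`, there are two independent rational points.  The other six binders and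
the conclusion are verbatim the route's; the twist's `Ш[p^∞]`-finiteness comes from `RankLeOne`
(analytic rank `0`), and `rank ≤ corank Sel = 2` from Greenberg's identity. -/
theorem closes_of_mockPointsW (hNV : MockNonVanishing) (hVK : VerticalKolyvagin) (hFS : FieldSupply)
    (hQuad : QuadraticSelmerCorank) (hMPW : MockPlecticPointsW) (hR1 : RankLeOne)
    (hRes : BSDOffTateSector) : _root_.BirchSwinnertonDyer := by
  have hId : ∀ (W : WeierstrassCurve ℚ), W.selmerCorank_eq_mordellWeilRank_add :=
    fun W => W.selmerCorank_eq_mordellWeilRank_add_holds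
  have hZ : ∀ (W : WeierstrassCurve ℚ) [W.IsElliptic] (p : ℕ) [Fact p.Prime],
      Finite ↥(AddCommGroup.primaryComponent W.sha p) → W.shaCorank p = 0 :=
    Literature.BSD.shaCorank_eq_zero_of_finite
  -- (T1) the Mordell–Weil rank is an isomorphism invariant (AEC III.3.1(b); `VariableChangePoints`)
  have hMW : ∀ (W : WeierstrassCurve ℚ) (C : WeierstrassCurve.VariableChange ℚ),
      (C • W).mordellWeilRank = W.mordellWeilRank := fun W C =>
    @WeierstrassCurve.VariableChange.finrank_point_variableChange ℚ _ W C (Classical.decEq ℚ)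
  -- (T2) the local Euler factor is an isomorphism invariant (AEC VII.1.3(b), VII.2, VII.5.1, C §16)
  have hloc : ∀ (R : Type) [CommRing R] [IsDomain R] [IsDiscreteValuationRing R]
      (K : Type) [Field K] [Algebra R K] [IsFractionRing R K]
      (W : WeierstrassCurve K) [W.IsElliptic] (C : WeierstrassCurve.VariableChange K),
      (C • W).localEulerFactor R = W.localEulerFactor R := by
    intro R _ _ _ K _ _ _ W _ C
    obtain ⟨D, hD⟩ : ∃ D : WeierstrassCurve.VariableChange K,
        (C • W).minimal R = D • W.minimal R :=
      ⟨((C • W).exists_isMinimal R).choose * C * ((W.exists_isMinimal R).choose)⁻¹, by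
        rw [WeierstrassCurve.minimal, WeierstrassCurve.minimal, mul_smul, mul_smul, inv_smul_smul]⟩
    haveI hE : (W.minimal R).IsElliptic := by rw [WeierstrassCurve.minimal]; infer_instance
    have hΔ : (W.minimal R).Δ ≠ 0 := (W.minimal R).isUnit_Δ.ne_zero
    have hgood : ((C • W).minimal R).HasGoodReduction R ↔ (W.minimal R).HasGoodReduction R := by
      rw [WeierstrassCurve.hasGoodReduction_iff, WeierstrassCurve.hasGoodReduction_iff,
        WeierstrassCurve.valuation_Δ_eq_of_isMinimal_of_eq_smul R hD]
      exact and_congr_left' ⟨fun _ => inferInstance, fun _ => inferInstance⟩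
    have hcard : Nat.card (((C • W).minimal R).reduction R).toAffine.Point =
        Nat.card ((W.minimal R).reduction R).toAffine.Point := by
      obtain ⟨E, hE⟩ := WeierstrassCurve.exists_reduction_eq_smul R hD hΔ
      rw [hE]
      exact WeierstrassCurve.natCard_point_smul _ _
    have hpoly : (C • W).localPolynomial R = W.localPolynomial R := by
      classical
      unfold WeierstrassCurve.localPolynomial
      simp only [hgood, hcard,
        WeierstrassCurve.hasSplitMultiplicativeReduction_iff_of_isMinimal_of_eq_smul R hD hΔ,
        WeierstrassCurve.hasMultiplicativeReduction_iff_of_isMinimal_of_eq_smul R hD hΔ]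
    simp only [WeierstrassCurve.localEulerFactor, WeierstrassCurve.localPowerSeries, hpoly]
  -- (T3) hence the analytic rank is an isomorphism invariant (AEC App. C §16)
  have hAn : ∀ (W : WeierstrassCurve ℚ) [W.IsElliptic] (C : WeierstrassCurve.VariableChange ℚ),
      (C • W).analyticRank = W.analyticRank := by
    intro W _ C
    have hL : (C • W).LFunction = W.LFunction := by
      unfold WeierstrassCurve.LFunction
      congr 1
      funext v
      simp only [WeierstrassCurve.baseChange, ← WeierstrassCurve.map_variableChange]
      exact hloc _ _ _ _
    have hLS : (C • W).LSeries = W.LSeries := by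
      funext s
      simp only [WeierstrassCurve.LSeries, hL]
    have hEC : (C • W).entireContinuations = W.entireContinuations := by
      simp only [WeierstrassCurve.entireContinuations, hLS]
    have hEL : (C • W).entireLFunction = W.entireLFunction := by
      unfold WeierstrassCurve.entireLFunction
      rw [hEC, hLS]
    simp only [WeierstrassCurve.analyticRank, hEL]
  -- BSD-rank on a global minimal model, in three regimes
  have key : ∀ (V : WeierstrassCurve ℚ) [V.IsElliptic] [V.IsGloballyMinimal],
      V.analyticRank = V.mordellWeilRank := by
    intro V _ _
    by_cases h1 : V.analyticRank ≤ 1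
    · exact ((hR1 V h1).1).symm
    by_cases hsec : ∃ (p M : ℕ) (_ : Fact p.Prime), 5 ≤ p ∧ V.conductorNorm ℤ = p * M ∧ ¬ p ∣ M ∧
        V.HasMultiplicativeReductionAtPrime p ∧
        ¬ ((V.baseChange ℚ_[p]).minimal ℤ_[p]).HasSplitMultiplicativeReduction ℤ_[p] ∧
        V.HasSurjectiveModNGaloisRep p ∧ V.analyticRank = 2
    · -- the non-split Tate sector: mock plectic certificate ⇒ corank 2 over K ⇒ corank 2 over ℚ
      obtain ⟨p, M, hp, h5, hN, hpM, hm, hns, hsurj, hr2⟩ := hsec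
      haveI := hp
      have hM0 : M ≠ 0 := by rintro rfl; exact hpM (dvd_zero p)
      haveI : NeZero (V.conductorNorm ℤ) := ⟨by rw [hN]; exact mul_ne_zero hp.out.ne_zero hM0⟩
      obtain ⟨K, _, _, β, c, hK2, hKc, hd4, hgcd, hinert, hβ, hMc, htw⟩ := hFS V p M hN hpM hr2
      obtain ⟨ι⟩ : Nonempty (K →+* ℂ) := inferInstance
      obtain ⟨Dt, n, τ, τ₁, L, L₁, y, σ, S, hn, hτ, hτ₁, hL, hL₁, hy, hσ, hS1, hS2, hcert⟩ :=
        hNV V p M h5 hN hpM hm hns hsurj hr2 K ι β c hK2 hKc hd4 hgcd hinert hβ hMc htw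
      have hK : (V.baseChange K).selmerCorank p = 2 :=
        hVK V p M h5 hN hpM hm hns hsurj (by omega) K ι β c hK2 hKc hd4 hgcd hinert hβ hMc Dt n τ τ₁ L L₁
          y σ S hn hτ hτ₁ hL hL₁ hy hσ hS1 hS2 hcert
      have hdec : (V.baseChange K).selmerCorank p =
          V.selmerCorank p + (V.quadraticTwist (NumberField.discr K : ℚ)).selmerCorank p :=
        hQuad V K hK2 p
      have hd : (NumberField.discr K : ℚ) ≠ 0 := by exact_mod_cast NumberField.discr_ne_zero K
      haveI := V.isElliptic_quadraticTwist hd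
      obtain ⟨hTrk, hTfin⟩ := hR1 (V.quadraticTwist (NumberField.discr K : ℚ)) (by omega)
      have hT1 := hId (V.quadraticTwist (NumberField.discr K : ℚ)) p
      -- the twist has analytic rank 0, so `RankLeOne` gives `Ш(E^K)` finite, hence `Ш(E^K)[p^∞]` finite
      haveI := hTfin
      have hT2 := hZ (V.quadraticTwist (NumberField.discr K : ℚ)) p inferInstance
      have hV1 := hId V p
      -- corank Sel_{p^∞}(E/ℚ) = 2 : this is ALL the mock-plectic machinery delivers
      have hVs : V.selmerCorank p = 2 := by omega
      -- two independent points, from the weakest consumed statement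
      have hPts : 2 ≤ V.mordellWeilRank :=
        hMPW V p M h5 hN hpM hm hns hsurj hr2 K ι β c hK2 hKc hd4 hgcd hinert hβ hMc htw Dt n τ τ₁ L L₁
          y σ S hn hτ hτ₁ hL hL₁ hy hσ hS1 hS2 hcert hVs
      omega
    · exact hRes V (by omega) hsec
  -- transport to an arbitrary model
  intro W hE
  haveI := hE
  obtain ⟨C, hC⟩ := WeierstrassCurve.hasGlobalMinimalModel_rat_holds W
  haveI := hC
  have h := key (C • W)
  rw [hAn W C, hMW W C] at h
  exact h

/-- **Certified replacement glue, Ш-form.** `closes` with the Ш-binder weakened to its consumed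
instance `ShaPFiniteOnTateSector`. -/
theorem closes_of_shaOnTateSector (hNV : MockNonVanishing) (hVK : VerticalKolyvagin) (hFS : FieldSupply)
    (hQuad : QuadraticSelmerCorank) (hShaS : ShaPFiniteOnTateSector) (hR1 : RankLeOne)
    (hRes : BSDOffTateSector) : _root_.BirchSwinnertonDyer :=
  closes_of_mockPointsW hNV hVK hFS hQuad (mockPointsW_of_shaOnTateSector hShaS) hR1 hRes

/-- **Certified replacement glue, points-form (the recommended re-target).** -/
theorem closes_of_mockPoints (hNV : MockNonVanishing) (hVK : VerticalKolyvagin) (hFS : FieldSupply)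
    (hQuad : QuadraticSelmerCorank) (hMP : MockPlecticPoints) (hR1 : RankLeOne)
    (hRes : BSDOffTateSector) : _root_.BirchSwinnertonDyer :=
  closes_of_mockPointsW hNV hVK hFS hQuad (mockPointsW_of_mockPoints hMP) hR1 hRes

/-- The points-form re-target is implied by the crux's consumed instance GIVEN the route's Selmer
machinery (so it is not stronger than what the route already bets on, slot for slot). -/
theorem mockPoints_of_shaOnTateSector (hVK : VerticalKolyvagin) (hQuad : QuadraticSelmerCorank)
    (hR1 : RankLeOne) (hShaS : ShaPFiniteOnTateSector) : MockPlecticPoints := by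
  intro W _ _ p M _ _ h5 hN hpM hm hns hsurj hr2 K _ _ ι β c hK2 hKc hd4 hgcd hinert hβ hMc htw Dt n τ τ₁ L L₁
    y σ S hn hτ hτ₁ hL hL₁ hy hσ hS1 hS2 hcert
  have hK : (W.baseChange K).selmerCorank p = 2 :=
    hVK W p M h5 hN hpM hm hns hsurj (by omega) K ι β c hK2 hKc hd4 hgcd hinert hβ hMc Dt n τ τ₁ L L₁
      y σ S hn hτ hτ₁ hL hL₁ hy hσ hS1 hS2 hcert
  have hdec := hQuad W K hK2 p
  have hd : (NumberField.discr K : ℚ) ≠ 0 := by exact_mod_cast NumberField.discr_ne_zero K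
  haveI := W.isElliptic_quadraticTwist hd
  obtain ⟨hTrk, hTfin⟩ := hR1 (W.quadraticTwist (NumberField.discr K : ℚ)) (by omega)
  have hT1 := selmer_eq_rank_add (W.quadraticTwist (NumberField.discr K : ℚ)) p
  haveI := hTfin
  have hT2 := Literature.BSD.shaCorank_eq_zero_of_finite (W.quadraticTwist (NumberField.discr K : ℚ)) p
    inferInstance
  have hVs : W.selmerCorank p = 2 := by omega
  exact shaOnTateSector_iff_pointsLB.mp hShaS W p M h5 hN hpM hm hns hsurj hr2 hVs

/-- **Hidden summit, assembled.** Modulo the route's other six items the consumed Ш-slot is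
*equivalent* to BSD-rank; by `shaOnTateSector_iff_pointsLB` its content is the rank lower bound on
the sector, which none of the six touches. -/
theorem consumedSlot_iff_summit_of_rest (hNV : MockNonVanishing) (hVK : VerticalKolyvagin)
    (hFS : FieldSupply) (hQuad : QuadraticSelmerCorank) (hR1 : RankLeOne) (hRes : BSDOffTateSector) :
    (ShaPFiniteOnTateSector ↔ _root_.BirchSwinnertonDyer) :=
  ⟨fun h => closes_of_shaOnTateSector hNV hVK hFS hQuad h hR1 hRes, shaOnTateSector_of_bsd⟩

/-- Sanity: the original `closes` factors through the weakened glue. -/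
theorem closes_factors (hNV : MockNonVanishing) (hVK : VerticalKolyvagin) (hFS : FieldSupply)
    (hQuad : QuadraticSelmerCorank) (hSha : SelmerRankShaPFinite) (hR1 : RankLeOne)
    (hRes : BSDOffTateSector) : _root_.BirchSwinnertonDyer :=
  closes_of_shaOnTateSector hNV hVK hFS hQuad (shaOnTateSector_of_crux hSha) hR1 hRes

/-! ## 2. Typed splits examined in the census (none filed — see `STRATEGY-CENSUS-r1.md` §Decomposition) -/

/-- Σ3 piece 1 — the `p`-parity theorem for all `E/ℚ`, all `p` (Dokchitser–Dokchitser 2010 Thm 1.4;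
tree fact `selmerCorank_mod_two_eq`, a theorem in print). -/
def PParityAll : Prop :=
  ∀ (W : WeierstrassCurve ℚ) [W.IsElliptic] (p : ℕ) [Fact p.Prime],
    Literature.NumberTheory.EllipticCurves.selmerCorank_mod_two_eq W p

/-- Σ3 piece 2 — Mordell–Weil parity for all `E/ℚ` (OPEN; known only given `Ш[p^∞]` finite at one `p`). -/
def MWParityAll : Prop :=
  ∀ (W : WeierstrassCurve ℚ) [W.IsElliptic], W.mordellWeilRank % 2 = W.analyticRank % 2

/-- Σ3 piece 3 — no two independent phantom classes: `corank Ш(E/ℚ)[p^∞] ≤ 1` (OPEN). -/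
def ShaCorankLeOneAll : Prop :=
  ∀ (W : WeierstrassCurve ℚ) [W.IsElliptic] (p : ℕ) [Fact p.Prime], W.shaCorank p ≤ 1

/-- Σ3 glue: parity makes `corank Ш[p^∞]` even, so `≤ 1` forces `0`. -/
theorem crux_of_paritySplit (hP : PParityAll) (hM : MWParityAll) (hL : ShaCorankLeOneAll) :
    SelmerRankShaPFinite := by
  intro W _ p _
  have h1 := selmer_eq_rank_add W p
  have h2 : W.selmerCorank p % 2 = W.analyticRank % 2 := hP W p
  have h3 := hM W
  have h4 := hL W p
  exact (finite_iff_shaCorank_zero W p).mpr (by omega)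

/-- Σ3 converse 1: the crux (with p-parity, a theorem) gives Mordell–Weil parity for every `E/ℚ`. -/
theorem mwParity_of_crux (hP : PParityAll) (h : SelmerRankShaPFinite) : MWParityAll := by
  intro W _
  haveI : Fact (Nat.Prime 2) := ⟨Nat.prime_two⟩
  have h1 := (crux_iff_selmerCorank_eq_rank.mp h) W 2
  have h2 : W.selmerCorank 2 % 2 = W.analyticRank % 2 := hP W 2
  omega

/-- Σ3 converse 2. -/
theorem shaCorankLeOne_of_crux (h : SelmerRankShaPFinite) : ShaCorankLeOneAll := by
  intro W _ p _
  have h2 := (finite_iff_shaCorank_zero W p).mp (h W p)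
  omega

/-- Σ3 at the consumed instance: piece 3 alone already produces a point of infinite order on an
analytic-rank-2 curve of the sector (`corank Ш ≤ 1 ∧ corank Sel = 2 ⇒ rank ≥ 1`). -/
theorem rank_pos_of_shaCorankLeOne (hL : ShaCorankLeOneAll) (W : WeierstrassCurve ℚ) [W.IsElliptic]
    (p : ℕ) [Fact p.Prime] (hs : W.selmerCorank p = 2) : 1 ≤ W.mordellWeilRank := by
  have h1 := selmer_eq_rank_add W p
  have h4 := hL W p
  omega

/-- Σ5 piece 1 — finiteness at ONE prime per curve (OPEN for `r_an ≥ 2`). -/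
def ShaFiniteAtOnePrime : Prop :=
  ∀ (W : WeierstrassCurve ℚ) [W.IsElliptic],
    ∃ (p : ℕ) (_ : Fact p.Prime), Finite ↥(AddCommGroup.primaryComponent W.sha p)

/-- Σ5 piece 2 — `p`-independence of `corank_{ℤ_p} Ш(E/ℚ)[p^∞]` (OPEN; known mod 2, next lemma). -/
def ShaCorankIndepOfP : Prop :=
  ∀ (W : WeierstrassCurve ℚ) [W.IsElliptic] (p q : ℕ) [Fact p.Prime] [Fact q.Prime],
    W.shaCorank p = W.shaCorank q

/-- Σ5 glue. -/
theorem crux_of_onePrimeSplit (h1 : ShaFiniteAtOnePrime) (h2 : ShaCorankIndepOfP) :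
    SelmerRankShaPFinite := by
  intro W _ p _
  obtain ⟨q, hq, hfin⟩ := h1 W
  haveI := hq
  have hq0 := (finite_iff_shaCorank_zero W q).mp hfin
  have hpq := h2 W p q
  exact (finite_iff_shaCorank_zero W p).mpr (by omega)

/-- Σ5, the known rung of piece 2: `corank Ш[p^∞] mod 2` does not depend on `p` (from p-parity). -/
theorem shaCorank_mod_two_indep_of_pParity (hP : PParityAll) (W : WeierstrassCurve ℚ) [W.IsElliptic]
    (p q : ℕ) [Fact p.Prime] [Fact q.Prime] : W.shaCorank p % 2 = W.shaCorank q % 2 := by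
  have a1 := selmer_eq_rank_add W p
  have a2 := selmer_eq_rank_add W q
  have b1 : W.selmerCorank p % 2 = W.analyticRank % 2 := hP W p
  have b2 : W.selmerCorank q % 2 = W.analyticRank % 2 := hP W q
  omega

/-- Σ5 converses: both pieces follow from the crux (so Σ5 is an honest equivalence-split, not a
weakening); piece 1 at an `r_an = 2` sector instance is again `rank = corank Sel` at that prime. -/
theorem onePrime_of_crux (h : SelmerRankShaPFinite) : ShaFiniteAtOnePrime := by
  intro W _
  exact ⟨2, ⟨Nat.prime_two⟩, h W 2⟩

theorem indep_of_crux (h : SelmerRankShaPFinite) : ShaCorankIndepOfP := by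
  intro W _ p q _ _
  have hp := (finite_iff_shaCorank_zero W p).mp (h W p)
  have hq := (finite_iff_shaCorank_zero W q).mp (h W q)
  omega

end Summit.BirchSwinnertonDyer.BirchSwinnertonDyer.Cruxes.SelmerRankShaPFinite.CensusR1
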